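import Summits.CriticalPhenomena.PercolationContinuityZ3.Theorems.Transplant.PlanarSkeletonFrmFromDefs
import Summits.CriticalPhenomena.PercolationContinuityZ3.Theorems.Transplant.SkelFrmFromBChoiceRegionsYW
import Summits.CriticalPhenomena.PercolationContinuityZ3.Theorems.Transplant.SkelFrmBChoiceRegionsYW
import Summits.CriticalPhenomena.PercolationContinuityZ3.Theorems.Transplant.SkelFrmFromBChoiceHabYW
import Summits.CriticalPhenomena.PercolationContinuityZ3.Theorems.Transplant.SkelFrmBChoiceHabYW
import Summits.CriticalPhenomena.PercolationContinuityZ3.Theorems.Transplant.SkelPhiCorridorKGYRegionsStep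
import Summits.CriticalPhenomena.PercolationContinuityZ3.Theorems.Transplant.SkelFrmFromBChoiceCreepY
import Summits.CriticalPhenomena.PercolationContinuityZ3.Theorems.Transplant.SkelFrmBChoiceCreepY
import HarnessLib
import Summits.CriticalPhenomena.PercolationContinuityZ3.Theorems.Transplant.SkelFrmBChoiceRegionsYV
/-!
# U-WAVE PORT (RULING D-U, lead g21 2026-08-26; WAVE-U-MANIFEST v3.0 row «SkelFrmBChoiceRegionsYV» ↦ «SkelFrmFromBChoiceRegionsYV») of the tree module
# `Transplant/SkelFrmBChoiceRegionsYV` onto the carrier `PlanarSkeletonFrmFrom` (frames only, cylinders connected from width `ℓ₀` on)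

ORIGINAL TITLE: N2 (frames-only node `SamePDropOfSkeletonFrm₁`, OPEN) — (ζ″) under (R-44)/(R-45): THE y′-CORRIDOR's PER-REGION READING ROWS AGAINST THE V ROOMS,

builds on p205010 (kernel theorem, internal audit signed; external expert review pending) — nothing in this file uses p205010; NOTHING is claimed about the
OPEN node U `SamePDropOfSkeletonFrmFrom₁` (nor U_s / the end state).  Lane `prim-bschramm`, seat `prim-hp-8 gen 53 (U-wave port pen, family P-hp8; tool of record = p3-g26 port_u.py)`; helper file
(`--supports stmt-CriticalPhenomena-4575 --as helper`).  PORT RULES r1–r4 of RULING D-U: declaration order and proof texts are those of the original,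
byte-identical except (i) the carrier token `PlanarSkeletonFrm ↦ PlanarSkeletonFrmFrom` (binders, `namespace`/`end` lines, qualified names of twinned
declarations), (ii) carrier-FREE declarations of the original (φ-level `Skelφ…` blocks and namespace-only arithmetic residents) are NOT re-declared —
this file imports the original and `export`s the twin-free residents (POLICY T / treatment (m1)); residents whose statement mentions a twinned
constant are copied, (iii) every carrier-binding declaration keeps its explicit binder `(Φ : PlanarSkeletonFrmFrom G)` in its own signature (r2).  Docstrings and citations are the original's.  Manifest row idx 159 (level 18; flags verbatim); filed by the hp-8 lineage under RULING M-11 (family P-hp8); hidden-dependency repairs: extra twin imports -; re-pointing opens ['--open-extra', 'PlanarSkeletonFrm.NegB=m2_mul_dec2_lt,regionY_core3'] (M-4).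
-/

open scoped Classical

noncomputable section

namespace Summit.CriticalPhenomena.PercolationContinuityZ3.Theorems.Transplant

namespace PlanarSkeletonFrmFrom

open PlanarSkeletonFrm.NegB (m2_mul_dec2_lt regionY_core3)

namespace NegB

open Literature.Probability.Percolation Literature.Probability.LatticeModels SimpleGraph
open SkelConc (Consts)
open Skelφ (shearUnit kgSL kgSLY kgM₁Y kgM₂Y kgE₁Y kgWm₂Y kgWp₂Y kgA₁Yp kgA₁Ym kgC₂Y dS rdLo rdHi KGYRows)
open TwoAxis.Para (modulus)
open Neg

section RegionsY

variable (κ : Consts) {V : Type} [DecidableEq V] [Countable V] {G : SimpleGraph V} [G.LocallyFinite] (Φ : PlanarSkeletonFrmFrom G) (t : V) (p : unitInterval)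
  (D : Skelφ.StepI.DataNS V) (g f mk : ℕ)

/- The tuple's atoms as hygiene-free local notations (they expand syntactically at each use; importers see the expanded terms; `HKᵣ` mentions the
   binders `hN hg` of the theorem it is used in). -/
set_option hygiene false in local notation "NYᵣ" => kgNYv0 κ Φ t p D g f mk (qxYQ4 κ Φ t p D g f) (WxYQ4 κ Φ t p D g f)
set_option hygiene false in local notation "qYᵣ" => kgqY κ Φ t p D g f (qxYQ4 κ Φ t p D g f)
set_option hygiene false in local notation "WYᵣ" => kgWY κ Φ t p D g f (WxYQ4 κ Φ t p D g f)
set_option hygiene false in local notation "Rᵣ" => kgR κ Φ t p D mk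
set_option hygiene false in local notation "nᵣ" => nL κ Φ t p D g f
set_option hygiene false in local notation "ℓᵣ" => ℓL κ Φ t p D g f
set_option hygiene false in local notation "hᵣ" => hL κ Φ t p D g f
set_option hygiene false in local notation "vᵣ" => vL κ Φ t p D g f
set_option hygiene false in local notation "Uᵣ" => shearUnit (nL κ Φ t p D g f) (hL κ Φ t p D g f)
set_option hygiene false in local notation "Δᵣ" => modulus (nL κ Φ t p D g f) (hL κ Φ t p D g f) (vL κ Φ t p D g f) (vβL κ Φ t p D g f)
set_option hygiene false in local notation "sLᵣ" => kgSL (nL κ Φ t p D g f) (ℓL κ Φ t p D g f) (hL κ Φ t p D g f)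
set_option hygiene false in local notation "s0ᵣ" => (((fcellsA κ Φ t p D g f).s 0 : ℕ) : ℤ)
set_option hygiene false in local notation "s1ᵣ" => (((fcellsA κ Φ t p D g f).s 1 : ℕ) : ℤ)
set_option hygiene false in local notation "r0ᵣ" => (((fcellsA κ Φ t p D g f).r 0 : ℕ) : ℤ)
set_option hygiene false in local notation "r1ᵣ" => (((fcellsA κ Φ t p D g f).r 1 : ℕ) : ℤ)
set_option hygiene false in local notation "Kᵣ" => ((Neg.K κ : ℕ) : ℤ)
set_option hygiene false in local notation "kqᵣ" => ((Neg.Kq κ : ℕ) : ℤ)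
set_option hygiene false in local notation "m1ᵣ" => kgM₁Y (nL κ Φ t p D g f) (vL κ Φ t p D g f) (kgR κ Φ t p D mk) 0 (kgWY κ Φ t p D g f (WxYQ4 κ Φ t p D g f)) (kgNYv0 κ Φ t p D g f mk (qxYQ4 κ Φ t p D g f) (WxYQ4 κ Φ t p D g f))
set_option hygiene false in local notation "m2ᵣ" => kgM₂Y (nL κ Φ t p D g f) (ℓL κ Φ t p D g f) (hL κ Φ t p D g f) (vL κ Φ t p D g f) (kgR κ Φ t p D mk) 0 (kgqY κ Φ t p D g f (qxYQ4 κ Φ t p D g f)) (kgWY κ Φ t p D g f (WxYQ4 κ Φ t p D g f)) (kgNYv0 κ Φ t p D g f mk (qxYQ4 κ Φ t p D g f) (WxYQ4 κ Φ t p D g f))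
set_option hygiene false in local notation "Wm2ᵣ" => kgWm₂Y (nL κ Φ t p D g f) (vL κ Φ t p D g f) (kgR κ Φ t p D mk) 0 (kgWY κ Φ t p D g f (WxYQ4 κ Φ t p D g f)) (kgNYv0 κ Φ t p D g f mk (qxYQ4 κ Φ t p D g f) (WxYQ4 κ Φ t p D g f))
set_option hygiene false in local notation "Wp2ᵣ" => kgWp₂Y (nL κ Φ t p D g f) (vL κ Φ t p D g f) (kgR κ Φ t p D mk) 0 (kgWY κ Φ t p D g f (WxYQ4 κ Φ t p D g f)) (kgNYv0 κ Φ t p D g f mk (qxYQ4 κ Φ t p D g f) (WxYQ4 κ Φ t p D g f))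
set_option hygiene false in local notation "HKᵣ" => kgYRows0_of κ Φ t p D g f mk (qxYQ4 κ Φ t p D g f) (WxYQ4 κ Φ t p D g f) hN hg
set_option hygiene false in local notation "rdLoᵣ" => rdLo (Aof κ) (nL κ Φ t p D g f) (hL κ Φ t p D g f) (vL κ Φ t p D g f) (vβL κ Φ t p D g f) (prFA κ Φ t p D g f).c₀ (prFA κ Φ t p D g f).c₁ (prFA κ Φ t p D g f).D
set_option hygiene false in local notation "rdHiᵣ" => rdHi (Aof κ) (nL κ Φ t p D g f) (hL κ Φ t p D g f) (vL κ Φ t p D g f) (vβL κ Φ t p D g f) (prFA κ Φ t p D g f).c₀ (prFA κ Φ t p D g f).c₁ (prFA κ Φ t p D g f).D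
set_option hygiene false in local notation "L3ᵣ" => ((3 * (nL κ Φ t p D g f * ℓL κ Φ t p D g f) / shearUnit (nL κ Φ t p D g f) (hL κ Φ t p D g f) + 1 : ℕ) : ℤ)
set_option hygiene false in local notation "P0ᵣ" => ((nL κ Φ t p D g f : ℕ) : ℤ) * ℓL κ Φ t p D g f / (shearUnit (nL κ Φ t p D g f) (hL κ Φ t p D g f) : ℕ)
set_option hygiene false in local notation "dSᵣ" => (((dS (nL κ Φ t p D g f) (ℓL κ Φ t p D g f) (hL κ Φ t p D g f) : ℕ)) : ℤ)
set_option hygiene false in local notation "Apᵣ" => ((kgA₁Yp (nL κ Φ t p D g f) (vL κ Φ t p D g f) (kgR κ Φ t p D mk) (kgWY κ Φ t p D g f (WxYQ4 κ Φ t p D g f)) (kgNYv0 κ Φ t p D g f mk (qxYQ4 κ Φ t p D g f) (WxYQ4 κ Φ t p D g f)) : ℕ) : ℤ)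
set_option hygiene false in local notation "Amᵣ" => ((kgA₁Ym (nL κ Φ t p D g f) (vL κ Φ t p D g f) (kgR κ Φ t p D mk) (kgWY κ Φ t p D g f (WxYQ4 κ Φ t p D g f)) (kgNYv0 κ Φ t p D g f mk (qxYQ4 κ Φ t p D g f) (WxYQ4 κ Φ t p D g f)) : ℕ) : ℤ)
set_option hygiene false in local notation "SCHᵣ" => Skelφ.kgCorrSchedY (HKᵣ).hn (HKᵣ).hv (HKᵣ).hlay ((HKᵣ).kgYVals_ok₁ NYᵣ) ((HKᵣ).kgYVals_ok₂ NYᵣ) ((HKᵣ).kgYVals_split NYᵣ)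

/-- **RUN REGION `k ≤ N`**: the drift-following box of `kgCorrSchedY_region_run_box` and its four reading rows. [this work] -/
theorem regionY_run_V (κ : Consts) {V : Type} [DecidableEq V] [Countable V] {G : SimpleGraph V} [G.LocallyFinite] (Φ : PlanarSkeletonFrmFrom G) (t : V) (p : unitInterval) (D : Skelφ.StepI.DataNS V) (g : ℕ) (f : ℕ) (mk : ℕ) (hKq : 5 ≤ Neg.Kq κ) (hN : EqNumL κ Φ t p D g f) (hg : gFloorKG κ Φ t p D mk ≤ g) (hg2 : 40 * Neg.K κ * KS0.R'0 κ Φ t p D mk ≤ g)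
    {k : ℕ} (hk : k ≤ NYᵣ) :
    ∃ lo hi : Site 2, (SCHᵣ).region (k) ⊆ Finset.Icc lo hi ∧ (-(5 * r1ᵣ) + 1 ≤ rdLoᵣ lo hi 1 ∧ rdHiᵣ lo hi 1 ≤ 22 * r1ᵣ - 1) ∧
        (-(2 * r0ᵣ) + 1 ≤ rdLoᵣ lo hi 0 ∧ rdHiᵣ lo hi 0 ≤ 2 * r0ᵣ - 1) ∧ rdHiᵣ lo hi 0 ≤ ((cRvY3 κ Φ t p D g f mk : ℕ) : ℤ) + 54 * s0ᵣ + 1 := by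
  obtain ⟨hsc0, hsc1, hn1, hA0, hDp, hm, hc₀, -, hkq, -⟩ := hsc_Q κ Φ t p D g f hN
  obtain ⟨hU1, h958, hUs, hΔU, hn1z, hv, hkq2, hs0, hs1, hr0, hr1, hN1, hNRn, hNRs, hWY, hnv1, hnv2, hq, h3L, hP0, hP1, hdS, ha1, ha2, hWsum, hR105n, hR105s, hK40s, hKq40, hR0, hSLX, hv1, hv2, hNdS, hL0, hNd0, hNR0, hAp, hAm, hC2⟩ := regionY_facts_W κ Φ t p D g f mk hKq hN hg hg2
  have hU0 : (0 : ℤ) ≤ ((Uᵣ : ℕ) : ℤ) := by linarith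
  have hU958 : ((Uᵣ : ℕ) : ℤ) * 958 ≤ ((Uᵣ : ℕ) : ℤ) * sLᵣ := mul_le_mul_of_nonneg_left h958 hU0
  obtain ⟨-, hs40', -, -, -, -⟩ := valsQ_floor κ Φ t p D g f mk hN hg hg2
  have hRR' : ((KS0.R'0 κ Φ t p D mk : ℕ) : ℤ) = ((Rᵣ : ℕ) : ℤ) := rfl
  rw [hRR'] at hs40'
  have hK200' : (200 : ℤ) ≤ Kᵣ := by linarith only [hKq40, hkq2]
  have hKR' : 200 * ((Rᵣ : ℕ) : ℤ) ≤ Kᵣ * ((Rᵣ : ℕ) : ℤ) := mul_le_mul_of_nonneg_right hK200' hR0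
  have eKR : (40 : ℤ) * Kᵣ * ((Rᵣ : ℕ) : ℤ) = 40 * (Kᵣ * ((Rᵣ : ℕ) : ℤ)) := by ring
  rw [eKR] at hs40'
  have hRsm' : 8000 * ((Rᵣ : ℕ) : ℤ) ≤ sLᵣ + 1 := by linarith only [hs40', hKR']
  have hNR2 : 40 * ((((NYᵣ : ℕ) : ℤ) + 1) * ((Rᵣ : ℕ) : ℤ)) ≤ 21 * (sLᵣ + 1) + 120 * ((Rᵣ : ℕ) : ℤ) := by
    have h1 : (((NYᵣ : ℕ) : ℤ) + 1) * ((Rᵣ : ℕ) : ℤ) ≤ (21 * Kᵣ + 3) * ((Rᵣ : ℕ) : ℤ) := mul_le_mul_of_nonneg_right (by linarith only [hN1, hKq40]) hR0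
    have e1 : (21 * Kᵣ + 3) * ((Rᵣ : ℕ) : ℤ) = 21 * (Kᵣ * ((Rᵣ : ℕ) : ℤ)) + 3 * ((Rᵣ : ℕ) : ℤ) := by ring
    linarith only [h1, e1, hs40']
  have hRU : ((Uᵣ : ℕ) : ℤ) * (8000 * ((Rᵣ : ℕ) : ℤ)) ≤ ((Uᵣ : ℕ) : ℤ) * (sLᵣ + 1) := mul_le_mul_of_nonneg_left hRsm' hU0
  have hkN : (k : ℤ) ≤ ((NYᵣ : ℕ) : ℤ) := by exact_mod_cast hk
  have hk0 : (0 : ℤ) ≤ (k : ℤ) := by positivity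
  have hkle : (k : ℤ) ≤ 840 * kqᵣ + 3 := by linarith
  have hkR : ((k : ℤ) + 1) * ((Rᵣ : ℕ) : ℤ) ≤ (((NYᵣ : ℕ) : ℤ) + 1) * ((Rᵣ : ℕ) : ℤ) := mul_le_mul_of_nonneg_right (by linarith) hR0
  have hkR0 : (0 : ℤ) ≤ ((k : ℤ) + 1) * ((Rᵣ : ℕ) : ℤ) := by positivity
  have hkP : (k : ℤ) * (P0ᵣ + 1) ≤ (k : ℤ) * (sLᵣ + 2) := mul_le_mul_of_nonneg_left (by linarith) hk0
  have hkP' : (k : ℤ) * sLᵣ ≤ (k : ℤ) * (P0ᵣ + 1) := mul_le_mul_of_nonneg_left (by linarith) hk0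
  have Blo0 : ((k : ℤ)) * vᵣ - 150 * ((nᵣ : ℕ) : ℤ) ≤ (k : ℤ) * vᵣ - (((((nᵣ : ℕ) : ℤ) + vᵣ).toNat + WYᵣ : ℕ) : ℤ) - ((k : ℤ) + 1) * (Rᵣ : ℕ) - (nᵣ : ℕ) := by
    push_cast; linarith only [hnv1, hWY, hkR, hNRn, hv1, hR0]
  have Bhi0 : (k : ℤ) * vᵣ + (((((nᵣ : ℕ) : ℤ) - vᵣ).toNat + WYᵣ : ℕ) : ℤ) + ((k : ℤ) + 1) * (Rᵣ : ℕ) + (nᵣ : ℕ) ≤ ((k : ℤ)) * vᵣ + 150 * ((nᵣ : ℕ) : ℤ) := by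
    push_cast; linarith only [hnv2, hWY, hkR, hNRn, hv2, hR0]
  have Blo1 : ((k : ℤ)) * sLᵣ - 26 * sLᵣ ≤ (k : ℤ) * sLᵣ - (qYᵣ : ℕ) - ((k : ℤ) + 1) * (Rᵣ : ℕ) - L3ᵣ := by
    push_cast; linarith only [hq, hP1, hkR, hNRs, h3L, h958, hR0]
  have Blh : (k : ℤ) * sLᵣ - (qYᵣ : ℕ) - ((k : ℤ) + 1) * (Rᵣ : ℕ) - L3ᵣ ≤
      (k : ℤ) * (P0ᵣ + 1) + (qYᵣ : ℕ) + ((k : ℤ) + 1) * (Rᵣ : ℕ) + L3ᵣ := by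
    push_cast; linarith only [hkP', hq, hP0, h958, hL0, hkR0]
  have Bhi1 : (k : ℤ) * (P0ᵣ + 1) + (qYᵣ : ℕ) + ((k : ℤ) + 1) * (Rᵣ : ℕ) + L3ᵣ ≤ ((k : ℤ)) * sLᵣ + 2 * ((k : ℤ)) + 26 * sLᵣ := by
    push_cast; linarith only [hkP, hq, hP1, hkR, hNRs, h3L, h958, hR0]
  refine ⟨![(k : ℤ) * vᵣ - (((((nᵣ : ℕ) : ℤ) + vᵣ).toNat + WYᵣ : ℕ) : ℤ) - ((k : ℤ) + 1) * (Rᵣ : ℕ) - (nᵣ : ℕ),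
      (k : ℤ) * sLᵣ - (qYᵣ : ℕ) - ((k : ℤ) + 1) * (Rᵣ : ℕ) - L3ᵣ],
    ![(k : ℤ) * vᵣ + (((((nᵣ : ℕ) : ℤ) - vᵣ).toNat + WYᵣ : ℕ) : ℤ) + ((k : ℤ) + 1) * (Rᵣ : ℕ) + (nᵣ : ℕ),
      (k : ℤ) * (P0ᵣ + 1) + (qYᵣ : ℕ) + ((k : ℤ) + 1) * (Rᵣ : ℕ) + L3ᵣ], ?_, ?_⟩
  · intro y hy
    obtain ⟨h1, h2, h3, h4⟩ := Skelφ.kgCorrSchedY_region_run_box (HKᵣ).hn (HKᵣ).hv (HKᵣ).hlay ((HKᵣ).kgYVals_ok₁ NYᵣ) ((HKᵣ).kgYVals_ok₂ NYᵣ) ((HKᵣ).kgYVals_split NYᵣ) hk hy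
    rw [Finset.mem_Icc, Pi.le_def, Pi.le_def, Fin.forall_fin_two, Fin.forall_fin_two]
    simp only [Matrix.cons_val_zero, Matrix.cons_val_one]
    exact ⟨⟨h3, h1⟩, h4, h2⟩
  · obtain ⟨C1, C2, C3, C4⟩ := regionY_core3 hU1 h958 hUs hΔU hn1z hv hkq2 hs0 hs1 hr0 hr1 hk0 hkle (by linarith) le_rfl Blo0 Bhi0 Blo1 Blh Bhi1
    refine ⟨⟨Skelφ.rdLo_one_geK (hD := hDp) (hm := hm) (hkq := hkq) (hsc1 := hsc1) C1, Skelφ.rdHi_one_leK (hD := hDp) (hm := hm) (hkq := hkq) (hsc1 := hsc1) C2⟩,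
      ⟨Skelφ.rdLo_zero_geK (hn := hn1) (hA := hA0) (hD := hDp) (hm := hm) (hc₀ := hc₀) (hkq := hkq) (hsc0 := hsc0) C3,
      Skelφ.rdHi_zero_leK (hn := hn1) (hD := hDp) (hm := hm) (hc₀ := hc₀) (hkq := hkq) (hsc0 := hsc0) C4⟩, ?_⟩
    refine habY_box_V κ Φ t p D g f mk hKq hN hg hg2 _ _ (kk := (k : ℤ)) (j := 0) (X0 := 2 * ((nᵣ : ℕ) : ℤ) + ((WYᵣ : ℕ) : ℤ) + ((k : ℤ) + 1) * ((Rᵣ : ℕ) : ℤ))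
      (Y0 := ((qYᵣ : ℕ) : ℤ) + ((k : ℤ) + 1) * ((Rᵣ : ℕ) : ℤ) + L3ᵣ) (Y1 := ((qYᵣ : ℕ) : ℤ) + ((k : ℤ) + 1) * ((Rᵣ : ℕ) : ℤ) + L3ᵣ) hk0 (by linarith) le_rfl (by norm_num)
      ?_ ?_ ?_ ?_ ?_ ?_ ?_ ?_ ?_
    · simp only [Matrix.cons_val_zero]; push_cast; linarith only [hnv2]
    · simp only [Matrix.cons_val_zero, Matrix.cons_val_one]; push_cast; linarith
    · simp only [Matrix.cons_val_zero, Matrix.cons_val_one]; push_cast; linarith only [hkP]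
    · simp only [Matrix.cons_val_zero, Matrix.cons_val_one]; exact Blh
    · linarith only [hWY, hkR, hR0]
    · push_cast; linarith only [hq, hP0, h958, hkR0, hL0]
    · have a : 40 * (((qYᵣ : ℕ) : ℤ) + ((k : ℤ) + 1) * ((Rᵣ : ℕ) : ℤ) + L3ᵣ) ≤ 941 * sLᵣ + 2021 + 120 * ((Rᵣ : ℕ) : ℤ) := by push_cast; linarith only [hq, hP1, hkR, hNR2, h3L]
      have b := mul_le_mul_of_nonneg_left a hU0
      linarith only [b, hUs, hU958, hRU, hU0, hR0]
    · push_cast; linarith only [hq, hP0, h958, hkR0, hL0]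
    · have a : 40 * (((qYᵣ : ℕ) : ℤ) + ((k : ℤ) + 1) * ((Rᵣ : ℕ) : ℤ) + L3ᵣ) ≤ 941 * sLᵣ + 2021 + 120 * ((Rᵣ : ℕ) : ℤ) := by push_cast; linarith only [hq, hP1, hkR, hNR2, h3L]
      have b := mul_le_mul_of_nonneg_left a hU0
      linarith only [b, hUs, hU958, hRU, hU0, hR0]

/-- **ACROSS-PARKING REGION `N+1+j`, `j ≤ m₁Y`**: the box of `kgCorrSchedY_region_park₁_box` and its four reading rows. [this work] -/
theorem regionY_park₁_V (κ : Consts) {V : Type} [DecidableEq V] [Countable V] {G : SimpleGraph V} [G.LocallyFinite] (Φ : PlanarSkeletonFrmFrom G) (t : V) (p : unitInterval) (D : Skelφ.StepI.DataNS V) (g : ℕ) (f : ℕ) (mk : ℕ) (hKq : 5 ≤ Neg.Kq κ) (hN : EqNumL κ Φ t p D g f) (hg : gFloorKG κ Φ t p D mk ≤ g) (hg2 : 40 * Neg.K κ * KS0.R'0 κ Φ t p D mk ≤ g)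
    {j : ℕ} (hj : j ≤ m1ᵣ) :
    ∃ lo hi : Site 2, (SCHᵣ).region (NYᵣ + 1 + j) ⊆ Finset.Icc lo hi ∧ (-(5 * r1ᵣ) + 1 ≤ rdLoᵣ lo hi 1 ∧ rdHiᵣ lo hi 1 ≤ 22 * r1ᵣ - 1) ∧
        (-(2 * r0ᵣ) + 1 ≤ rdLoᵣ lo hi 0 ∧ rdHiᵣ lo hi 0 ≤ 2 * r0ᵣ - 1) ∧ rdHiᵣ lo hi 0 ≤ ((cRvY3 κ Φ t p D g f mk : ℕ) : ℤ) + 54 * s0ᵣ + 1 := by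
  obtain ⟨hsc0, hsc1, hn1, hA0, hDp, hm, hc₀, -, hkq, -⟩ := hsc_Q κ Φ t p D g f hN
  obtain ⟨hU1, h958, hUs, hΔU, hn1z, hv, hkq2, hs0, hs1, hr0, hr1, hN1, hNRn, hNRs, hWY, hnv1, hnv2, hq, h3L, hP0, hP1, hdS, ha1, ha2, hWsum, hR105n, hR105s, hK40s, hKq40, hR0, hSLX, hv1, hv2, hNdS, hL0, hNd0, hNR0, hAp, hAm, hC2⟩ := regionY_facts_W κ Φ t p D g f mk hKq hN hg hg2
  have hU0 : (0 : ℤ) ≤ ((Uᵣ : ℕ) : ℤ) := by linarith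
  have hU958 : ((Uᵣ : ℕ) : ℤ) * 958 ≤ ((Uᵣ : ℕ) : ℤ) * sLᵣ := mul_le_mul_of_nonneg_left h958 hU0
  obtain ⟨-, hs40', -, -, -, -⟩ := valsQ_floor κ Φ t p D g f mk hN hg hg2
  have hRR' : ((KS0.R'0 κ Φ t p D mk : ℕ) : ℤ) = ((Rᵣ : ℕ) : ℤ) := rfl
  rw [hRR'] at hs40'
  have hK200' : (200 : ℤ) ≤ Kᵣ := by linarith only [hKq40, hkq2]
  have hKR' : 200 * ((Rᵣ : ℕ) : ℤ) ≤ Kᵣ * ((Rᵣ : ℕ) : ℤ) := mul_le_mul_of_nonneg_right hK200' hR0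
  have eKR : (40 : ℤ) * Kᵣ * ((Rᵣ : ℕ) : ℤ) = 40 * (Kᵣ * ((Rᵣ : ℕ) : ℤ)) := by ring
  rw [eKR] at hs40'
  have hRsm' : 8000 * ((Rᵣ : ℕ) : ℤ) ≤ sLᵣ + 1 := by linarith only [hs40', hKR']
  have hNR2 : 40 * ((((NYᵣ : ℕ) : ℤ) + 1) * ((Rᵣ : ℕ) : ℤ)) ≤ 21 * (sLᵣ + 1) + 120 * ((Rᵣ : ℕ) : ℤ) := by
    have h1 : (((NYᵣ : ℕ) : ℤ) + 1) * ((Rᵣ : ℕ) : ℤ) ≤ (21 * Kᵣ + 3) * ((Rᵣ : ℕ) : ℤ) := mul_le_mul_of_nonneg_right (by linarith only [hN1, hKq40]) hR0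
    have e1 : (21 * Kᵣ + 3) * ((Rᵣ : ℕ) : ℤ) = 21 * (Kᵣ * ((Rᵣ : ℕ) : ℤ)) + 3 * ((Rᵣ : ℕ) : ℤ) := by ring
    linarith only [h1, e1, hs40']
  have hRU : ((Uᵣ : ℕ) : ℤ) * (8000 * ((Rᵣ : ℕ) : ℤ)) ≤ ((Uᵣ : ℕ) : ℤ) * (sLᵣ + 1) := mul_le_mul_of_nonneg_left hRsm' hU0
  have hjm : (j : ℤ) ≤ ((m1ᵣ : ℕ) : ℤ) := by exact_mod_cast hj
  have hN0 : (0 : ℤ) ≤ ((NYᵣ : ℕ) : ℤ) + 1 := by positivity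
  have hjR : (j : ℤ) * ((Rᵣ : ℕ) : ℤ) ≤ 197 * ((Rᵣ : ℕ) : ℤ) := mul_le_mul_of_nonneg_right (by linarith) hR0
  have hj0' : (0 : ℤ) ≤ (j : ℤ) * ((Rᵣ : ℕ) : ℤ) := by positivity
  have Blo0 : ((((NYᵣ : ℕ) : ℤ) + 1)) * vᵣ - 150 * ((nᵣ : ℕ) : ℤ) ≤ (((NYᵣ : ℕ) : ℤ) + 1) * vᵣ - Amᵣ - 2 * (nᵣ : ℕ) - (Rᵣ : ℕ) := by
    linarith only [hAm, hWY, hv1, hNRn, hR105n, hR0]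
  have Bhi0 : (((NYᵣ : ℕ) : ℤ) + 1) * vᵣ + Apᵣ + (j : ℤ) * (((Rᵣ : ℕ) : ℤ) + ((0 : ℕ) : ℤ)) + (Rᵣ : ℕ) + (nᵣ : ℕ) ≤ ((((NYᵣ : ℕ) : ℤ) + 1)) * vᵣ + 150 * ((nᵣ : ℕ) : ℤ) := by
    push_cast; linarith only [hAp, hWY, hv2, hNRn, hjR, hR105n, hR0]
  have Blo1 : ((((NYᵣ : ℕ) : ℤ) + 1)) * sLᵣ - 26 * sLᵣ ≤ (((NYᵣ : ℕ) : ℤ) + 1) * sLᵣ - (((qYᵣ : ℕ) : ℤ) + (((NYᵣ : ℕ) : ℤ) + 1) * (Rᵣ : ℕ)) - (j : ℤ) * (((Rᵣ : ℕ) : ℤ) + ((0 : ℕ) : ℤ)) - (Rᵣ : ℕ) - L3ᵣ := by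
    push_cast; linarith only [hq, hP1, hNRs, hjR, hR105s, h3L, h958, hR0]
  have Blh : (((NYᵣ : ℕ) : ℤ) + 1) * sLᵣ - (((qYᵣ : ℕ) : ℤ) + (((NYᵣ : ℕ) : ℤ) + 1) * (Rᵣ : ℕ)) - (j : ℤ) * (((Rᵣ : ℕ) : ℤ) + ((0 : ℕ) : ℤ)) - (Rᵣ : ℕ) - L3ᵣ ≤
      (((NYᵣ : ℕ) : ℤ) + 1) * sLᵣ + (((qYᵣ : ℕ) : ℤ) + (((NYᵣ : ℕ) : ℤ) + 1) * (Rᵣ : ℕ) + (((NYᵣ : ℕ) : ℤ) + 1) * dSᵣ) + (j : ℤ) * (((Rᵣ : ℕ) : ℤ) + ((0 : ℕ) : ℤ)) + (Rᵣ : ℕ) + L3ᵣ := by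
    push_cast; linarith only [hj0', hNd0, hq, hP0, h958, hL0, hNR0, hR0]
  have Bhi1 : (((NYᵣ : ℕ) : ℤ) + 1) * sLᵣ + (((qYᵣ : ℕ) : ℤ) + (((NYᵣ : ℕ) : ℤ) + 1) * (Rᵣ : ℕ) + (((NYᵣ : ℕ) : ℤ) + 1) * dSᵣ) + (j : ℤ) * (((Rᵣ : ℕ) : ℤ) + ((0 : ℕ) : ℤ)) + (Rᵣ : ℕ) + L3ᵣ ≤ ((((NYᵣ : ℕ) : ℤ) + 1)) * sLᵣ + 2 * ((((NYᵣ : ℕ) : ℤ) + 1)) + 26 * sLᵣ := by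
    push_cast; linarith only [hq, hP1, hNRs, hNdS, hjR, hR105s, h3L, h958, hR0]
  refine ⟨![(((NYᵣ : ℕ) : ℤ) + 1) * vᵣ - Amᵣ - 2 * (nᵣ : ℕ) - (Rᵣ : ℕ),
      (((NYᵣ : ℕ) : ℤ) + 1) * sLᵣ - (((qYᵣ : ℕ) : ℤ) + (((NYᵣ : ℕ) : ℤ) + 1) * (Rᵣ : ℕ)) - (j : ℤ) * (((Rᵣ : ℕ) : ℤ) + ((0 : ℕ) : ℤ)) - (Rᵣ : ℕ) - L3ᵣ],
    ![(((NYᵣ : ℕ) : ℤ) + 1) * vᵣ + Apᵣ + (j : ℤ) * (((Rᵣ : ℕ) : ℤ) + ((0 : ℕ) : ℤ)) + (Rᵣ : ℕ) + (nᵣ : ℕ),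
      (((NYᵣ : ℕ) : ℤ) + 1) * sLᵣ + (((qYᵣ : ℕ) : ℤ) + (((NYᵣ : ℕ) : ℤ) + 1) * (Rᵣ : ℕ) + (((NYᵣ : ℕ) : ℤ) + 1) * dSᵣ) + (j : ℤ) * (((Rᵣ : ℕ) : ℤ) + ((0 : ℕ) : ℤ)) + (Rᵣ : ℕ) + L3ᵣ], ?_, ?_⟩
  · intro y hy
    obtain ⟨h1, h2, h3, h4⟩ := Skelφ.kgCorrSchedY_region_park₁_box (HKᵣ).hn (HKᵣ).hv (HKᵣ).hlay ((HKᵣ).kgYVals_ok₁ NYᵣ) ((HKᵣ).kgYVals_ok₂ NYᵣ) ((HKᵣ).kgYVals_split NYᵣ) hj hy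
    rw [Finset.mem_Icc, Pi.le_def, Pi.le_def, Fin.forall_fin_two, Fin.forall_fin_two]
    simp only [Matrix.cons_val_zero, Matrix.cons_val_one]
    exact ⟨⟨h3, h1⟩, h4, h2⟩
  · obtain ⟨C1, C2, C3, C4⟩ := regionY_core3 hU1 h958 hUs hΔU hn1z hv hkq2 hs0 hs1 hr0 hr1 hN0 hN1 (by linarith) le_rfl Blo0 Bhi0 Blo1 Blh Bhi1
    refine ⟨⟨Skelφ.rdLo_one_geK (hD := hDp) (hm := hm) (hkq := hkq) (hsc1 := hsc1) C1, Skelφ.rdHi_one_leK (hD := hDp) (hm := hm) (hkq := hkq) (hsc1 := hsc1) C2⟩,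
      ⟨Skelφ.rdLo_zero_geK (hn := hn1) (hA := hA0) (hD := hDp) (hm := hm) (hc₀ := hc₀) (hkq := hkq) (hsc0 := hsc0) C3,
      Skelφ.rdHi_zero_leK (hn := hn1) (hD := hDp) (hm := hm) (hc₀ := hc₀) (hkq := hkq) (hsc0 := hsc0) C4⟩, ?_⟩
    refine habY_box_V κ Φ t p D g f mk hKq hN hg hg2 _ _ (kk := (((NYᵣ : ℕ) : ℤ) + 1)) (j := 0)
      (X0 := ((nᵣ : ℕ) : ℤ) + ((WYᵣ : ℕ) : ℤ) + (((NYᵣ : ℕ) : ℤ) + 1) * ((Rᵣ : ℕ) : ℤ) + (j : ℤ) * (((Rᵣ : ℕ) : ℤ) + ((0 : ℕ) : ℤ)) + ((Rᵣ : ℕ) : ℤ) + ((nᵣ : ℕ) : ℤ))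
      (Y0 := ((qYᵣ : ℕ) : ℤ) + (((NYᵣ : ℕ) : ℤ) + 1) * ((Rᵣ : ℕ) : ℤ) + (j : ℤ) * (((Rᵣ : ℕ) : ℤ) + ((0 : ℕ) : ℤ)) + ((Rᵣ : ℕ) : ℤ) + L3ᵣ)
      (Y1 := ((qYᵣ : ℕ) : ℤ) + (((NYᵣ : ℕ) : ℤ) + 1) * ((Rᵣ : ℕ) : ℤ) + (((NYᵣ : ℕ) : ℤ) + 1) * dSᵣ + (j : ℤ) * (((Rᵣ : ℕ) : ℤ) + ((0 : ℕ) : ℤ)) + ((Rᵣ : ℕ) : ℤ) + L3ᵣ) hN0 le_rfl le_rfl (by norm_num)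
      ?_ ?_ ?_ ?_ ?_ ?_ ?_ ?_ ?_
    · simp only [Matrix.cons_val_zero]; push_cast; linarith only [hAp]
    · simp only [Matrix.cons_val_zero, Matrix.cons_val_one]; push_cast; linarith
    · simp only [Matrix.cons_val_zero, Matrix.cons_val_one]; push_cast; linarith only [hN0]
    · simp only [Matrix.cons_val_zero, Matrix.cons_val_one]; exact Blh
    · push_cast; linarith only [hWY, hjR, hR0]
    · push_cast; linarith only [hq, hP0, h958, hNR0, hj0', hR0, hL0]
    · have a : 40 * (((qYᵣ : ℕ) : ℤ) + (((NYᵣ : ℕ) : ℤ) + 1) * ((Rᵣ : ℕ) : ℤ) + (j : ℤ) * (((Rᵣ : ℕ) : ℤ) + ((0 : ℕ) : ℤ)) + ((Rᵣ : ℕ) : ℤ) + L3ᵣ) ≤ 941 * sLᵣ + 2021 + 8040 * ((Rᵣ : ℕ) : ℤ) := by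
        push_cast; linarith only [hq, hP1, hNR2, hjR, h3L]
      have b := mul_le_mul_of_nonneg_left a hU0
      linarith only [b, hUs, hU958, hRU, hU0, hR0]
    · push_cast; linarith only [hq, hP0, h958, hNR0, hNd0, hj0', hR0, hL0]
    · have a : 40 * (((qYᵣ : ℕ) : ℤ) + (((NYᵣ : ℕ) : ℤ) + 1) * ((Rᵣ : ℕ) : ℤ) + (((NYᵣ : ℕ) : ℤ) + 1) * dSᵣ + (j : ℤ) * (((Rᵣ : ℕ) : ℤ) + ((0 : ℕ) : ℤ)) + ((Rᵣ : ℕ) : ℤ) + L3ᵣ) ≤ 983 * sLᵣ + 2303 + 8040 * ((Rᵣ : ℕ) : ℤ) := by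
        push_cast; linarith only [hq, hP1, hNR2, hNdS, hN1, hK40s, hKq40, hjR, h3L]
      have b := mul_le_mul_of_nonneg_left a hU0
      linarith only [b, hUs, hU958, hRU, hU0, hR0]

/-- **ALONG-PARKING REGION `N+1+m₁Y+1+j`, `j ≤ m₂Y`, STEP BOX** (p5-g16's `kgCorrSchedY_region_park₂_box_step`: rows cut to the remaining along
window `max (E₀ − j·dec₂) (P₀)`, which `m2_mul_dec2_lt` shows is the first argument): the four reading rows of `hPRY_W`'s shape and the V habitat row. [this work] -/
theorem regionY_park₂_V (κ : Consts) {V : Type} [DecidableEq V] [Countable V] {G : SimpleGraph V} [G.LocallyFinite] (Φ : PlanarSkeletonFrmFrom G) (t : V) (p : unitInterval) (D : Skelφ.StepI.DataNS V) (g : ℕ) (f : ℕ) (mk : ℕ) (hKq : 5 ≤ Neg.Kq κ) (hN : EqNumL κ Φ t p D g f) (hg : gFloorKG κ Φ t p D mk ≤ g) (hg2 : 40 * Neg.K κ * KS0.R'0 κ Φ t p D mk ≤ g)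
    {j : ℕ} (hj : j ≤ m2ᵣ) :
    ∃ lo hi : Site 2, (SCHᵣ).region (NYᵣ + 1 + m1ᵣ + 1 + j) ⊆ Finset.Icc lo hi ∧ (-(5 * r1ᵣ) + 1 ≤ rdLoᵣ lo hi 1 ∧ rdHiᵣ lo hi 1 ≤ 22 * r1ᵣ - 1) ∧
        (-(2 * r0ᵣ) + 1 ≤ rdLoᵣ lo hi 0 ∧ rdHiᵣ lo hi 0 ≤ 2 * r0ᵣ - 1) ∧ rdHiᵣ lo hi 0 ≤ ((cRvY3 κ Φ t p D g f mk : ℕ) : ℤ) + 54 * s0ᵣ + 1 := by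
  obtain ⟨hsc0, hsc1, hn1, hA0, hDp, hm, hc₀, -, hkq, -⟩ := hsc_Q κ Φ t p D g f hN
  obtain ⟨hU1, h958, hUs, hΔU, hn1z, hv, hkq2, hs0, hs1, hr0, hr1, hN1, hNRn, hNRs, hWY, hnv1, hnv2, hq, h3L, hP0, hP1, hdS, ha1, ha2, hWsum, hR105n, hR105s, hK40s, hKq40, hR0, hSLX, hv1, hv2, hNdS, hL0, hNd0, hNR0, hAp, hAm, hC2⟩ := regionY_facts_W κ Φ t p D g f mk hKq hN hg hg2
  have hU0 : (0 : ℤ) ≤ ((Uᵣ : ℕ) : ℤ) := by linarith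
  have hU958 : ((Uᵣ : ℕ) : ℤ) * 958 ≤ ((Uᵣ : ℕ) : ℤ) * sLᵣ := mul_le_mul_of_nonneg_left h958 hU0
  obtain ⟨-, hs40', -, -, -, -⟩ := valsQ_floor κ Φ t p D g f mk hN hg hg2
  have hRR' : ((KS0.R'0 κ Φ t p D mk : ℕ) : ℤ) = ((Rᵣ : ℕ) : ℤ) := rfl
  rw [hRR'] at hs40'
  have hK200' : (200 : ℤ) ≤ Kᵣ := by linarith only [hKq40, hkq2]
  have hKR' : 200 * ((Rᵣ : ℕ) : ℤ) ≤ Kᵣ * ((Rᵣ : ℕ) : ℤ) := mul_le_mul_of_nonneg_right hK200' hR0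
  have eKR : (40 : ℤ) * Kᵣ * ((Rᵣ : ℕ) : ℤ) = 40 * (Kᵣ * ((Rᵣ : ℕ) : ℤ)) := by ring
  rw [eKR] at hs40'
  have hRsm' : 8000 * ((Rᵣ : ℕ) : ℤ) ≤ sLᵣ + 1 := by linarith only [hs40', hKR']
  have hNR2 : 40 * ((((NYᵣ : ℕ) : ℤ) + 1) * ((Rᵣ : ℕ) : ℤ)) ≤ 21 * (sLᵣ + 1) + 120 * ((Rᵣ : ℕ) : ℤ) := by
    have h1 : (((NYᵣ : ℕ) : ℤ) + 1) * ((Rᵣ : ℕ) : ℤ) ≤ (21 * Kᵣ + 3) * ((Rᵣ : ℕ) : ℤ) := mul_le_mul_of_nonneg_right (by linarith only [hN1, hKq40]) hR0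
    have e1 : (21 * Kᵣ + 3) * ((Rᵣ : ℕ) : ℤ) = 21 * (Kᵣ * ((Rᵣ : ℕ) : ℤ)) + 3 * ((Rᵣ : ℕ) : ℤ) := by ring
    linarith only [h1, e1, hs40']
  have hRU : ((Uᵣ : ℕ) : ℤ) * (8000 * ((Rᵣ : ℕ) : ℤ)) ≤ ((Uᵣ : ℕ) : ℤ) * (sLᵣ + 1) := mul_le_mul_of_nonneg_left hRsm' hU0
  have hjm : (j : ℤ) ≤ ((m2ᵣ : ℕ) : ℤ) := by exact_mod_cast hj
  have hN0 : (0 : ℤ) ≤ ((NYᵣ : ℕ) : ℤ) + 1 := by positivity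
  have hva : 0 ≤ |vᵣ| := abs_nonneg _
  have hjR : (j : ℤ) * (((Rᵣ : ℕ) : ℤ) + 0 + |vᵣ|) ≤ 41 * (((Rᵣ : ℕ) : ℤ) + ((nᵣ : ℕ) : ℤ)) := mul_le_mul (by linarith) (by linarith) (by positivity) (by norm_num)
  have hj0' : (0 : ℤ) ≤ (j : ℤ) * (((Rᵣ : ℕ) : ℤ) + 0 + |vᵣ|) := by positivity
  have hjRb : (j : ℤ) * ((Rᵣ : ℕ) : ℤ) ≤ 41 * ((Rᵣ : ℕ) : ℤ) := mul_le_mul_of_nonneg_right (by linarith) hR0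
  have hjRb0 : (0 : ℤ) ≤ (j : ℤ) * ((Rᵣ : ℕ) : ℤ) := by positivity
  have hm1R : ((((m1ᵣ : ℕ) : ℤ)) + 1) * ((Rᵣ : ℕ) : ℤ) ≤ 198 * ((Rᵣ : ℕ) : ℤ) := mul_le_mul_of_nonneg_right ha1 hR0
  have hm1R0 : (0 : ℤ) ≤ ((((m1ᵣ : ℕ) : ℤ)) + 1) * ((Rᵣ : ℕ) : ℤ) := by positivity
  have hWm0 : (0 : ℤ) ≤ ((Wm2ᵣ : ℕ) : ℤ) := Nat.cast_nonneg _
  have hWp0 : (0 : ℤ) ≤ ((Wp2ᵣ : ℕ) : ℤ) := Nat.cast_nonneg _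
  have hC2' := hC2
  push_cast at hC2'
  have Blo0 : ((((NYᵣ : ℕ) : ℤ) + 1)) * vᵣ - 150 * ((nᵣ : ℕ) : ℤ) ≤ kgC₂Y nᵣ ℓᵣ hᵣ vᵣ Rᵣ 0 qYᵣ WYᵣ NYᵣ m1ᵣ Wp2ᵣ 0 - (Wm2ᵣ : ℕ) - (j : ℤ) * (((Rᵣ : ℕ) : ℤ) + ((0 : ℕ) : ℤ) + |vᵣ|) - (Rᵣ : ℕ) - (nᵣ : ℕ) := by
    push_cast; linarith only [hC2', hAp, hWY, hv1, hR0, hm1R0, hWsum, hWp0, hjR, hR105n, hN0, hNRn]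
  have Bhi0 : kgC₂Y nᵣ ℓᵣ hᵣ vᵣ Rᵣ 0 qYᵣ WYᵣ NYᵣ m1ᵣ Wp2ᵣ 0 + (Wp2ᵣ : ℕ) + (j : ℤ) * (((Rᵣ : ℕ) : ℤ) + ((0 : ℕ) : ℤ) + |vᵣ|) + (Rᵣ : ℕ) + (nᵣ : ℕ) ≤ ((((NYᵣ : ℕ) : ℤ) + 1)) * vᵣ + 150 * ((nᵣ : ℕ) : ℤ) := by
    push_cast; linarith only [hC2', hAp, hWY, hv2, hNRn, hm1R, hjR, hR105n, hR0, hWm0, hWsum]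
  have hj35 : (j : ℤ) ≤ 41 := by linarith
  have hj0 : (0 : ℤ) ≤ (j : ℤ) := by positivity
  have hjd0 : (0 : ℤ) ≤ (j : ℤ) * (sLᵣ - 2 * ((Rᵣ : ℕ) : ℤ)) := mul_nonneg hj0 (by linarith)
  have hmaxle : max ((2 * (((qYᵣ : ℕ) : ℤ) + (((NYᵣ : ℕ) : ℤ) + 1) * (Rᵣ : ℕ)) + (((NYᵣ : ℕ) : ℤ) + 1) * dSᵣ + 2 * ((((m1ᵣ : ℕ) : ℤ) + 1) * (((Rᵣ : ℕ) : ℤ) + ((0 : ℕ) : ℤ)))) - (j : ℤ) * (sLᵣ - 2 * ((Rᵣ : ℕ) : ℤ) - ((0 : ℕ) : ℤ))) (P0ᵣ + 1 + ((0 : ℕ) : ℤ) - 1) ≤ (2 * (((qYᵣ : ℕ) : ℤ) + (((NYᵣ : ℕ) : ℤ) + 1) * (Rᵣ : ℕ)) + (((NYᵣ : ℕ) : ℤ) + 1) * dSᵣ + 2 * ((((m1ᵣ : ℕ) : ℤ) + 1) * (((Rᵣ : ℕ) : ℤ) + ((0 : ℕ) : ℤ)))) + (P0ᵣ + 1) :=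 by
    refine max_le ?_ ?_
    · push_cast; linarith only [hjd0, hP0, h958]
    · push_cast; linarith only [hq, hP0, h958, hNR0, hNd0, hm1R0]
  have hmaxge : P0ᵣ ≤ max ((2 * (((qYᵣ : ℕ) : ℤ) + (((NYᵣ : ℕ) : ℤ) + 1) * (Rᵣ : ℕ)) + (((NYᵣ : ℕ) : ℤ) + 1) * dSᵣ + 2 * ((((m1ᵣ : ℕ) : ℤ) + 1) * (((Rᵣ : ℕ) : ℤ) + ((0 : ℕ) : ℤ)))) - (j : ℤ) * (sLᵣ - 2 * ((Rᵣ : ℕ) : ℤ) - ((0 : ℕ) : ℤ))) (P0ᵣ + 1 + ((0 : ℕ) : ℤ) - 1) := by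
    have := le_max_right ((2 * (((qYᵣ : ℕ) : ℤ) + (((NYᵣ : ℕ) : ℤ) + 1) * (Rᵣ : ℕ)) + (((NYᵣ : ℕ) : ℤ) + 1) * dSᵣ + 2 * ((((m1ᵣ : ℕ) : ℤ) + 1) * (((Rᵣ : ℕ) : ℤ) + ((0 : ℕ) : ℤ)))) - (j : ℤ) * (sLᵣ - 2 * ((Rᵣ : ℕ) : ℤ) - ((0 : ℕ) : ℤ))) (P0ᵣ + 1 + ((0 : ℕ) : ℤ) - 1)
    push_cast at this ⊢; linarith only [this]
  have Blo1 : ((((NYᵣ : ℕ) : ℤ) + 1)) * sLᵣ - 26 * sLᵣ ≤ (((NYᵣ : ℕ) : ℤ) + 1) * sLᵣ + (((qYᵣ : ℕ) : ℤ) + (((NYᵣ : ℕ) : ℤ) + 1) * (Rᵣ : ℕ) + (((NYᵣ : ℕ) : ℤ) + 1) * dSᵣ) + (((m1ᵣ : ℕ) : ℤ) + 1) * (((Rᵣ : ℕ) : ℤ) + ((0 : ℕ) : ℤ)) + (j : ℤ) * (((Rᵣ : ℕ) : ℤ) + ((0 : ℕ) : ℤ)) - max ((2 * (((qYᵣ :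 ℕ) : ℤ) + (((NYᵣ : ℕ) : ℤ) + 1) * (Rᵣ : ℕ)) + (((NYᵣ : ℕ) : ℤ) + 1) * dSᵣ + 2 * ((((m1ᵣ : ℕ) : ℤ) + 1) * (((Rᵣ : ℕ) : ℤ) + ((0 : ℕ) : ℤ)))) - (j : ℤ) * (sLᵣ - 2 * ((Rᵣ : ℕ) : ℤ) - ((0 : ℕ) : ℤ))) (P0ᵣ + 1 + ((0 : ℕ) : ℤ) - 1) - (Rᵣ : ℕ) - L3ᵣ := by
    push_cast at hmaxle ⊢; linarith only [hmaxle, hq, hP1, hNRs, hNdS, hN1, hK40s, hKq40, hm1R, hjRb, hjRb0, hRsm', h3L, h958, hR0]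
  have Blh : (((NYᵣ : ℕ) : ℤ) + 1) * sLᵣ + (((qYᵣ : ℕ) : ℤ) + (((NYᵣ : ℕ) : ℤ) + 1) * (Rᵣ : ℕ) + (((NYᵣ : ℕ) : ℤ) + 1) * dSᵣ) + (((m1ᵣ : ℕ) : ℤ) + 1) * (((Rᵣ : ℕ) : ℤ) + ((0 : ℕ) : ℤ)) + (j : ℤ) * (((Rᵣ : ℕ) : ℤ) + ((0 : ℕ) : ℤ)) - max ((2 * (((qYᵣ : ℕ) : ℤ) + (((NYᵣ : ℕ) : ℤ) + 1) * (Rᵣ : ℕ)) + (((NYᵣ : ℕ) : ℤ) + 1) * dSᵣ + 2 * ((((m1ᵣ : ℕ) : ℤ) + 1) * (((Rᵣ : ℕ) : ℤ) + ((0 : ℕ) : ℤ)))) - (j : ℤ) * (sLᵣ - 2 * ((Rᵣ : ℕ) : ℤ) - ((0 : ℕ) : ℤ))) (P0ᵣ + 1 + ((0 : ℕ) : ℤ) - 1) - (Rᵣ : ℕ) - L3ᵣ ≤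
      (((NYᵣ : ℕ) : ℤ) + 1) * sLᵣ + (((qYᵣ : ℕ) : ℤ) + (((NYᵣ : ℕ) : ℤ) + 1) * (Rᵣ : ℕ) + (((NYᵣ : ℕ) : ℤ) + 1) * dSᵣ) + (((m1ᵣ : ℕ) : ℤ) + 1) * (((Rᵣ : ℕ) : ℤ) + ((0 : ℕ) : ℤ)) + (j : ℤ) * (((Rᵣ : ℕ) : ℤ) + ((0 : ℕ) : ℤ)) + (Rᵣ : ℕ) + L3ᵣ := by
    push_cast at hmaxge ⊢; linarith only [hmaxge, hP0, h958, hL0, hR0]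
  have Bhi1 : (((NYᵣ : ℕ) : ℤ) + 1) * sLᵣ + (((qYᵣ : ℕ) : ℤ) + (((NYᵣ : ℕ) : ℤ) + 1) * (Rᵣ : ℕ) + (((NYᵣ : ℕ) : ℤ) + 1) * dSᵣ) + (((m1ᵣ : ℕ) : ℤ) + 1) * (((Rᵣ : ℕ) : ℤ) + ((0 : ℕ) : ℤ)) + (j : ℤ) * (((Rᵣ : ℕ) : ℤ) + ((0 : ℕ) : ℤ)) + (Rᵣ : ℕ) + L3ᵣ ≤ ((((NYᵣ : ℕ) : ℤ) + 1)) * sLᵣ + 2 * ((((NYᵣ : ℕ) : ℤ) + 1)) + 26 * sLᵣ := by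
    push_cast; linarith only [hq, hP1, hNRs, hNdS, hm1R, hjRb, hRsm', h3L, h958, hR0]
  refine ⟨![kgC₂Y nᵣ ℓᵣ hᵣ vᵣ Rᵣ 0 qYᵣ WYᵣ NYᵣ m1ᵣ Wp2ᵣ 0 - (Wm2ᵣ : ℕ) - (j : ℤ) * (((Rᵣ : ℕ) : ℤ) + ((0 : ℕ) : ℤ) + |vᵣ|) - (Rᵣ : ℕ) - (nᵣ : ℕ),
      (((NYᵣ : ℕ) : ℤ) + 1) * sLᵣ + (((qYᵣ : ℕ) : ℤ) + (((NYᵣ : ℕ) : ℤ) + 1) * (Rᵣ : ℕ) + (((NYᵣ : ℕ) : ℤ) + 1) * dSᵣ) + (((m1ᵣ : ℕ) : ℤ) + 1) * (((Rᵣ : ℕ) : ℤ) + ((0 : ℕ) : ℤ)) + (j : ℤ) * (((Rᵣ : ℕ) : ℤ) + ((0 : ℕ) : ℤ)) - max ((2 * (((qYᵣ : ℕ) : ℤ) + (((NYᵣ : ℕ) : ℤ) + 1) * (Rᵣ : ℕ)) + (((NYᵣ : ℕ) : ℤ) + 1) * dSᵣ + 2 * ((((m1ᵣ : ℕ) : ℤ)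 + 1) * (((Rᵣ : ℕ) : ℤ) + ((0 : ℕ) : ℤ)))) - (j : ℤ) * (sLᵣ - 2 * ((Rᵣ : ℕ) : ℤ) - ((0 : ℕ) : ℤ))) (P0ᵣ + 1 + ((0 : ℕ) : ℤ) - 1) - (Rᵣ : ℕ) - L3ᵣ],
    ![kgC₂Y nᵣ ℓᵣ hᵣ vᵣ Rᵣ 0 qYᵣ WYᵣ NYᵣ m1ᵣ Wp2ᵣ 0 + (Wp2ᵣ : ℕ) + (j : ℤ) * (((Rᵣ : ℕ) : ℤ) + ((0 : ℕ) : ℤ) + |vᵣ|) + (Rᵣ : ℕ) + (nᵣ : ℕ),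
      (((NYᵣ : ℕ) : ℤ) + 1) * sLᵣ + (((qYᵣ : ℕ) : ℤ) + (((NYᵣ : ℕ) : ℤ) + 1) * (Rᵣ : ℕ) + (((NYᵣ : ℕ) : ℤ) + 1) * dSᵣ) + (((m1ᵣ : ℕ) : ℤ) + 1) * (((Rᵣ : ℕ) : ℤ) + ((0 : ℕ) : ℤ)) + (j : ℤ) * (((Rᵣ : ℕ) : ℤ) + ((0 : ℕ) : ℤ)) + (Rᵣ : ℕ) + L3ᵣ], ?_, ?_⟩
  · intro y hy
    obtain ⟨h1, h2, h3, h4⟩ := Skelφ.kgCorrSchedY_region_park₂_box_step (HKᵣ).hn (HKᵣ).hv (HKᵣ).hlay ((HKᵣ).kgYVals_ok₁ NYᵣ) ((HKᵣ).kgYVals_ok₂ NYᵣ) ((HKᵣ).kgYVals_split NYᵣ) j hy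
    rw [Finset.mem_Icc, Pi.le_def, Pi.le_def, Fin.forall_fin_two, Fin.forall_fin_two]
    simp only [Matrix.cons_val_zero, Matrix.cons_val_one]
    exact ⟨⟨h3, h1⟩, h4, h2⟩
  · obtain ⟨C1, C2, C3, C4⟩ := regionY_core3 hU1 h958 hUs hΔU hn1z hv hkq2 hs0 hs1 hr0 hr1 hN0 hN1 (by linarith) le_rfl Blo0 Bhi0 Blo1 Blh Bhi1
    refine ⟨⟨Skelφ.rdLo_one_geK (hD := hDp) (hm := hm) (hkq := hkq) (hsc1 := hsc1) C1, Skelφ.rdHi_one_leK (hD := hDp) (hm := hm) (hkq := hkq) (hsc1 := hsc1) C2⟩,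
      ⟨Skelφ.rdLo_zero_geK (hn := hn1) (hA := hA0) (hD := hDp) (hm := hm) (hc₀ := hc₀) (hkq := hkq) (hsc0 := hsc0) C3,
      Skelφ.rdHi_zero_leK (hn := hn1) (hD := hDp) (hm := hm) (hc₀ := hc₀) (hkq := hkq) (hsc0 := hsc0) C4⟩, ?_⟩
    -- the V habitat row: every step `j ≤ m₂Y` still sees the window `E₀ − j·dec₂ ≥ P₀` (`m2_mul_dec2_lt`)
    have hlt := m2_mul_dec2_lt (HKᵣ) NYᵣ (by
      unfold Skelφ.kgTY; push_cast; linarith only [hq, hP0, h958, hNR0, hNd0, hm1R0, hR0])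
    obtain ⟨-, hd2eq⟩ := dec₁Y_eq_Q κ Φ t p D g f mk
    rw [hd2eq] at hlt
    have hjd2 : (j : ℤ) * (sLᵣ - 2 * ((Rᵣ : ℕ) : ℤ)) ≤ ((m2ᵣ : ℕ) : ℤ) * (sLᵣ - 2 * ((Rᵣ : ℕ) : ℤ)) := mul_le_mul_of_nonneg_right hjm (by linarith)
    have hc : P0ᵣ + 1 + ((0 : ℕ) : ℤ) - 1 ≤ (2 * (((qYᵣ : ℕ) : ℤ) + (((NYᵣ : ℕ) : ℤ) + 1) * (Rᵣ : ℕ)) + (((NYᵣ : ℕ) : ℤ) + 1) * dSᵣ + 2 * ((((m1ᵣ : ℕ) : ℤ) + 1) * (((Rᵣ : ℕ) : ℤ) + ((0 : ℕ) : ℤ)))) - (j : ℤ) * (sLᵣ - 2 * ((Rᵣ : ℕ) : ℤ) - ((0 : ℕ) : ℤ)) := by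
      unfold Skelφ.kgTY at hlt; push_cast at hlt ⊢; linarith only [hlt, hjd2]
    refine habY_box_V κ Φ t p D g f mk hKq hN hg hg2 _ _ (kk := (((NYᵣ : ℕ) : ℤ) + 1)) (j := (j : ℤ))
      (X0 := ((nᵣ : ℕ) : ℤ) + ((WYᵣ : ℕ) : ℤ) + (((NYᵣ : ℕ) : ℤ) + 1) * ((Rᵣ : ℕ) : ℤ) + (((m1ᵣ : ℕ) : ℤ) + 1) * (((Rᵣ : ℕ) : ℤ) + ((0 : ℕ) : ℤ)) + ((Rᵣ : ℕ) : ℤ) + ((nᵣ : ℕ) : ℤ))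
      (Y0 := ((qYᵣ : ℕ) : ℤ) + (((NYᵣ : ℕ) : ℤ) + 1) * ((Rᵣ : ℕ) : ℤ) + (((m1ᵣ : ℕ) : ℤ) + 1) * (((Rᵣ : ℕ) : ℤ) + ((0 : ℕ) : ℤ)) + ((Rᵣ : ℕ) : ℤ) + L3ᵣ)
      (Y1 := (((qYᵣ : ℕ) : ℤ) + (((NYᵣ : ℕ) : ℤ) + 1) * (Rᵣ : ℕ) + (((NYᵣ : ℕ) : ℤ) + 1) * dSᵣ) + (((m1ᵣ : ℕ) : ℤ) + 1) * (((Rᵣ : ℕ) : ℤ) + ((0 : ℕ) : ℤ)) + (j : ℤ) * (((Rᵣ : ℕ) : ℤ) + ((0 : ℕ) : ℤ)) + ((Rᵣ : ℕ) : ℤ) + L3ᵣ) hN0 le_rfl hj0 hj35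
      ?_ ?_ ?_ ?_ ?_ ?_ ?_ ?_ ?_
    · simp only [Matrix.cons_val_zero]; push_cast; linarith only [hC2', hAp]
    · simp only [Matrix.cons_val_zero, Matrix.cons_val_one]; rw [max_eq_left hc]; push_cast; linarith
    · simp only [Matrix.cons_val_zero, Matrix.cons_val_one]; push_cast; linarith only [hN0]
    · simp only [Matrix.cons_val_zero, Matrix.cons_val_one]; exact Blh
    · push_cast; linarith only [hWY, hm1R, hR0]
    · push_cast; linarith only [hq, hP0, h958, hNR0, hm1R0, hR0, hL0]
    · have a : 40 * (((qYᵣ : ℕ) : ℤ) + (((NYᵣ : ℕ) : ℤ) + 1) * ((Rᵣ : ℕ) : ℤ) + (((m1ᵣ : ℕ) : ℤ) + 1) * (((Rᵣ : ℕ) : ℤ) + ((0 : ℕ) : ℤ)) + ((Rᵣ : ℕ) : ℤ) + L3ᵣ) ≤ 941 * sLᵣ + 2021 + 8080 * ((Rᵣ : ℕ) : ℤ) := by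
        push_cast; linarith only [hq, hP1, hNR2, hm1R, h3L]
      have b := mul_le_mul_of_nonneg_left a hU0
      linarith only [b, hUs, hU958, hRU, hU0, hR0]
    · push_cast; linarith only [hq, hP0, h958, hNR0, hNd0, hm1R0, hjRb0, hR0, hL0]
    · have a : 40 * ((((qYᵣ : ℕ) : ℤ) + (((NYᵣ : ℕ) : ℤ) + 1) * (Rᵣ : ℕ) + (((NYᵣ : ℕ) : ℤ) + 1) * dSᵣ) + (((m1ᵣ : ℕ) : ℤ) + 1) * (((Rᵣ : ℕ) : ℤ) + ((0 : ℕ) : ℤ)) + (j : ℤ) * (((Rᵣ : ℕ) : ℤ) + ((0 : ℕ) : ℤ)) + ((Rᵣ : ℕ) : ℤ) + L3ᵣ) ≤ 983 * sLᵣ + 2303 + 9720 * ((Rᵣ : ℕ) : ℤ) := by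
        push_cast; linarith only [hq, hP1, hNR2, hNdS, hN1, hK40s, hKq40, hm1R, hjRb, h3L]
      have b := mul_le_mul_of_nonneg_left a hU0
      linarith only [b, hUs, hU958, hRU, hU0, hR0]

/-- **THE y′-CORRIDOR's PER-REGION READING ROWS AGAINST THE V ROOMS**: every region of `kgCorrSchedY` (at `HK := kgYRows0_of …`, `N := kgNYv0 …`)
lies in a frame box reading inside `[−5r₁+1, 22r₁−1] × [−2r₀+1, 2r₀−1]` and below the tight affine forward room, `rdHi₀ ≤ cRvY3 + 54·s₀ + 1`. [this work] -/
theorem hPRY_V (κ : Consts) {V : Type} [DecidableEq V] [Countable V] {G : SimpleGraph V} [G.LocallyFinite] (Φ : PlanarSkeletonFrmFrom G) (t : V) (p : unitInterval) (D : Skelφ.StepI.DataNS V) (g : ℕ) (f : ℕ) (mk : ℕ) (hKq : 5 ≤ Neg.Kq κ) (hN : EqNumL κ Φ t p D g f) (hg : gFloorKG κ Φ t p D mk ≤ g) (hg2 : 40 * Neg.K κ * KS0.R'0 κ Φ t p D mk ≤ g) :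
    ∀ k ≤ (SCHᵣ).N, ∃ lo hi : Site 2, (SCHᵣ).region k ⊆ Finset.Icc lo hi ∧ (-(5 * r1ᵣ) + 1 ≤ rdLoᵣ lo hi 1 ∧ rdHiᵣ lo hi 1 ≤ 22 * r1ᵣ - 1) ∧
        (-(2 * r0ᵣ) + 1 ≤ rdLoᵣ lo hi 0 ∧ rdHiᵣ lo hi 0 ≤ 2 * r0ᵣ - 1) ∧ rdHiᵣ lo hi 0 ≤ ((cRvY3 κ Φ t p D g f mk : ℕ) : ℤ) + 54 * s0ᵣ + 1 := by
  intro k hk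
  have hSN : (SCHᵣ).N = NYᵣ + 1 + m1ᵣ + 1 + m2ᵣ := (Skelφ.kgCorrSchedY_params _ _ _ _ _ _).1
  rw [hSN] at hk
  rcases le_or_gt k NYᵣ with hk1 | hk1
  · exact regionY_run_V κ Φ t p D g f mk hKq hN hg hg2 hk1
  · rcases le_or_gt k (NYᵣ + 1 + m1ᵣ) with hk2 | hk2
    · obtain ⟨j, rfl⟩ : ∃ j, k = NYᵣ + 1 + j := ⟨k - (NYᵣ + 1), by omega⟩
      exact regionY_park₁_V κ Φ t p D g f mk hKq hN hg hg2 (by omega)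
    · obtain ⟨j, rfl⟩ : ∃ j, k = NYᵣ + 1 + m1ᵣ + 1 + j := ⟨k - (NYᵣ + 1 + m1ᵣ + 1), by omega⟩
      exact regionY_park₂_V κ Φ t p D g f mk hKq hN hg hg2 (by omega)

end RegionsY

end NegB

end PlanarSkeletonFrmFrom

end Summit.CriticalPhenomena.PercolationContinuityZ3.Theorems.Transplant

end
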